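import Mathlib
import HarnessLib
import Summits.HubbardSuperconductivity.HubbardSuperconductivity.Theorems.KLProgrammeH10TwoPointLimitPerturbedFermiRadius

/-!
# Route `KLProgramme` — definitions: the PERTURBED band Fermi radius `u_E(θ)` of `{ε₀ + δ = μ}`

Cell gate-hubbard-kl, crux K1 `H10TwoPointLimit` (stmt-HubbardSuperconductivity-19938) / K3 child 2 (the counterterm frame).
The theorem file `KLProgrammeH10TwoPointLimitPerturbedFermiRadius.lean` works with an unnamed Fermi point `t` of the perturbed
dispersion `E = ε₀ + δ` on the ray `θ`, read as the tree's `IsBandFermiRadius (μ - δ(t·dir θ)) θ t` (free Fermi point of the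
shifted level), and proves existence / level shift / closeness / uniqueness; `…PerturbedFermiRadiusSmooth.lean` proves that ANY
selection of such points is `Cⁿ` with the implicit derivative. This file only NAMES the canonical selection, exactly as the tree
names `bandFermiRadius μ θ := Classical.epsilon (IsBandFermiRadius μ θ)` (the case `δ = 0`):

* `perturbedFermiRadius δ μ θ` — Hilbert's `ε` of `t ↦ IsBandFermiRadius (μ - δ(t·dir θ)) θ t`: the polar radius of the
  interacting Fermi curve `{ε₀ + δ = μ}` along the ray `θ` (BGM 2006's `u(θ)` of the scale-`h` curve `{E_h = μ}`, §2.4 (2.40); in the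
  counterterm scheme `δ = -K`, the curve `{e_K = 0}` of `frameLevel μ K`);

and records its defining property and the `rfl`/`ε`-level bookkeeping: it IS a Fermi point whenever `δ` is continuous with
`|δ| ≤ κ₀` on the closed square and `[μ - κ₀, μ + κ₀] ⊂ [a, b] ⊂ (-4, 0)`; it is THE Fermi point under the radial Lipschitz bound
`κ₁ < Dt_min`; `perturbedFermiRadius 0 = bandFermiRadius`; periodicity and (for even `δ`) central symmetry hold at the level of the
defining predicates (no uniqueness needed); and the order-zero consequences of the theorem file restated for the named radius.
No analysis beyond that is done here. Reference: G. Benfatto, A. Giuliani, V. Mastropietro, Ann. Henri Poincaré 7 (2006) 809–898,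
§2.4 Lemma 2.1 (2.40).
-/

noncomputable section

namespace Summit.HubbardSuperconductivity.HubbardSuperconductivity.Theorems.PerturbedFermiCurve

set_option linter.dupNamespace false -- summit = problem name (single-conjunct summit), D-0017

open Real Set
open Literature.MathematicalPhysics.QuantumLattice Literature.MathematicalPhysics.QuantumLattice.BandSectorCounting

/-- **The perturbed band Fermi radius `u_E(θ)`** of the dispersion `E = ε₀ + δ` at level `μ` along the ray of angle `θ`:
Hilbert's `ε` of the defining property `IsBandFermiRadius (μ - δ(t·dir θ)) θ t` (`t ≥ 0` in the closed square with
`ε₀(t·dir θ) + δ(t·dir θ) = μ`); unspecified junk when no such point exists. At `δ = 0` it is `bandFermiRadius μ θ`. -/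
def perturbedFermiRadius (δ : (Fin 2 → ℝ) → ℝ) (μ θ : ℝ) : ℝ :=
  Classical.epsilon fun t => IsBandFermiRadius (μ - δ (t • dir θ)) θ t

/-- **`δ = 0`**: the perturbed Fermi radius of the zero perturbation is the tree's band Fermi radius (same `ε`-term). -/
theorem perturbedFermiRadius_zero (μ θ : ℝ) : perturbedFermiRadius 0 μ θ = bandFermiRadius μ θ := by
  unfold perturbedFermiRadius bandFermiRadius
  simp only [Pi.zero_apply, sub_zero]

/-- Rays whose defining predicates coincide have the same perturbed Fermi radius (Hilbert's `ε` of equal predicates). -/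
theorem perturbedFermiRadius_congr {δ δ' : (Fin 2 → ℝ) → ℝ} {μ μ' θ θ' : ℝ}
    (h : ∀ t, IsBandFermiRadius (μ' - δ' (t • dir θ')) θ' t ↔ IsBandFermiRadius (μ - δ (t • dir θ)) θ t) :
    perturbedFermiRadius δ' μ' θ' = perturbedFermiRadius δ μ θ := by
  unfold perturbedFermiRadius
  rw [show (fun t => IsBandFermiRadius (μ' - δ' (t • dir θ')) θ' t) = fun t => IsBandFermiRadius (μ - δ (t • dir θ)) θ t from
    funext fun t => propext (h t)]

/-- **Periodicity**: `u_E(θ + 2π) = u_E(θ)`, for every `δ` and `μ`. -/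
theorem perturbedFermiRadius_add_two_pi (δ : (Fin 2 → ℝ) → ℝ) (μ θ : ℝ) :
    perturbedFermiRadius δ μ (θ + 2 * π) = perturbedFermiRadius δ μ θ :=
  perturbedFermiRadius_congr fun t => isBandFermiRadius_shifted_add_two_pi δ μ θ t

/-- **Central symmetry**: for an even perturbation, `u_E(θ + π) = u_E(θ)`. -/
theorem perturbedFermiRadius_add_pi {δ : (Fin 2 → ℝ) → ℝ} (heven : ∀ k, δ (-k) = δ k) (μ θ : ℝ) :
    perturbedFermiRadius δ μ (θ + π) = perturbedFermiRadius δ μ θ :=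
  perturbedFermiRadius_congr fun t => isBandFermiRadius_shifted_add_pi heven μ θ t

section Spec

variable {a b : ℝ} (B : BandBounds a b) {δ : (Fin 2 → ℝ) → ℝ} (hδc : Continuous δ) {κ₀ : ℝ}
  (hδ : ∀ k : Fin 2 → ℝ, (∀ i, |k i| ≤ π) → |δ k| ≤ κ₀) {μ : ℝ} (hlo : a ≤ μ - κ₀) (hhi : μ + κ₀ ≤ b)
include B hδc hδ hlo hhi

/-- **The perturbed Fermi radius is a Fermi point of `ε₀ + δ`** (a free Fermi point of the shifted level), whenever `δ` is
continuous with `|δ| ≤ κ₀` on the closed square and `[μ - κ₀, μ + κ₀] ⊂ [a, b]`. -/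
theorem isBandFermiRadius_perturbedFermiRadius (θ : ℝ) :
    IsBandFermiRadius (μ - δ (perturbedFermiRadius δ μ θ • dir θ)) θ (perturbedFermiRadius δ μ θ) := by
  obtain ⟨t, -, ht⟩ := exists_isBandFermiRadius_shifted' B hδc hδ hlo hhi θ
  exact Classical.epsilon_spec (p := fun t => IsBandFermiRadius (μ - δ (t • dir θ)) θ t) ⟨t, ht⟩

/-- **`ε₀(u_E·dir θ) + δ(u_E·dir θ) = μ`**: the polar curve lies on the perturbed Fermi curve. -/
theorem sqDispersion_add_perturbedFermiRadius (θ : ℝ) :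
    sqDispersion (perturbedFermiRadius δ μ θ • dir θ) + δ (perturbedFermiRadius δ μ θ • dir θ) = μ :=
  ((isBandFermiRadius_shifted_iff δ μ θ _).1 (isBandFermiRadius_perturbedFermiRadius B hδc hδ hlo hhi θ)).2

/-- **Level-shift identity**: `u_E(θ) = u_{μ - δ(u_E(θ)·dir θ)}(θ)`. -/
theorem perturbedFermiRadius_eq_bandFermiRadius (θ : ℝ) :
    perturbedFermiRadius δ μ θ = bandFermiRadius (μ - δ (perturbedFermiRadius δ μ θ • dir θ)) θ :=
  eq_bandFermiRadius_of_shifted B hδ hlo hhi (isBandFermiRadius_perturbedFermiRadius B hδc hδ hlo hhi θ)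

/-- The shifted level of `u_E(θ)` lies in `[a, b]`. -/
theorem shiftedLevel_perturbedFermiRadius_mem_Icc (θ : ℝ) :
    μ - δ (perturbedFermiRadius δ μ θ • dir θ) ∈ Icc a b :=
  shiftedLevel_mem_Icc (isBandFermiRadius_perturbedFermiRadius B hδc hδ hlo hhi θ) hδ hlo hhi

/-- `u_min ≤ u_E(θ)`. -/
theorem umin_le_perturbedFermiRadius (θ : ℝ) : B.umin ≤ perturbedFermiRadius δ μ θ :=
  umin_le_of_shifted B hδ hlo hhi (isBandFermiRadius_perturbedFermiRadius B hδc hδ hlo hhi θ)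

/-- `u_E(θ) ∈ (0, π/‖dir θ‖)`. -/
theorem perturbedFermiRadius_mem_Ioo (θ : ℝ) : perturbedFermiRadius δ μ θ ∈ Ioo 0 (π / ‖dir θ‖) :=
  mem_Ioo_of_shifted B hδ hlo hhi (isBandFermiRadius_perturbedFermiRadius B hδc hδ hlo hhi θ)

/-- The perturbed Fermi curve lies in the open square. -/
theorem abs_perturbedFermiRadius_smul_dir_lt (θ : ℝ) (i : Fin 2) : |(perturbedFermiRadius δ μ θ • dir θ) i| < π :=
  abs_apply_lt_pi_of_shifted B hδ hlo hhi (isBandFermiRadius_perturbedFermiRadius B hδc hδ hlo hhi θ) i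

/-- Transversality at the perturbed Fermi point: `∂_t ε₀ ≥ Dt_min`. -/
theorem Dtmin_le_rayDispersionDt_perturbedFermiRadius (θ : ℝ) :
    B.Dtmin ≤ rayDispersionDt θ (perturbedFermiRadius δ μ θ) :=
  Dtmin_le_rayDispersionDt_of_shifted B hδ hlo hhi (isBandFermiRadius_perturbedFermiRadius B hδc hδ hlo hhi θ)

/-- **BGM 2006 (2.40), order zero**: `|u_E(θ) - u_μ(θ)| ≤ κ₀/Dt_min`, uniformly in `θ`. -/
theorem abs_perturbedFermiRadius_sub_bandFermiRadius_le (θ : ℝ) :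
    |perturbedFermiRadius δ μ θ - bandFermiRadius μ θ| ≤ κ₀ / B.Dtmin :=
  abs_sub_bandFermiRadius_le_of_shifted B hδ hlo hhi (isBandFermiRadius_perturbedFermiRadius B hδc hδ hlo hhi θ)

/-- Sandwich by the free radii of the levels `μ ∓ κ₀`. -/
theorem bandFermiRadius_le_perturbedFermiRadius_le (θ : ℝ) :
    bandFermiRadius (μ - κ₀) θ ≤ perturbedFermiRadius δ μ θ ∧ perturbedFermiRadius δ μ θ ≤ bandFermiRadius (μ + κ₀) θ :=
  bandFermiRadius_le_and_le_of_shifted B hδ hlo hhi (isBandFermiRadius_perturbedFermiRadius B hδc hδ hlo hhi θ)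

/-- **Uniqueness**: under the radial Lipschitz bound `κ₁ < Dt_min` on the ray `θ`, every Fermi point of `ε₀ + δ` at level `μ`
on that ray is `u_E(θ)`. -/
theorem eq_perturbedFermiRadius_of_isBandFermiRadius {κ₁ θ t : ℝ}
    (hL : ∀ s t : ℝ, s ∈ Icc 0 (π / ‖dir θ‖) → t ∈ Icc 0 (π / ‖dir θ‖) →
      |δ (s • dir θ) - δ (t • dir θ)| ≤ κ₁ * |s - t|)
    (hκ₁ : κ₁ < B.Dtmin) (ht : IsBandFermiRadius (μ - δ (t • dir θ)) θ t) : t = perturbedFermiRadius δ μ θ :=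
  shifted_unique B hδ hlo hhi hL hκ₁ ht (isBandFermiRadius_perturbedFermiRadius B hδc hδ hlo hhi θ)

end Spec

end Summit.HubbardSuperconductivity.HubbardSuperconductivity.Theorems.PerturbedFermiCurve

end
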